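import Mathlib
import Summits.ValiantsHypothesis.ValiantsHypothesis.Theorems.RigidityForcesSymmetryRankRigidMinimalReprLaplaceFourDefs
import Summits.ValiantsHypothesis.ValiantsHypothesis.Theorems.RigidityForcesSymmetryRankRigidMinimalReprLaplaceFourPencil
import Summits.ValiantsHypothesis.ValiantsHypothesis.Theorems.RigidityForcesSymmetryRankRigidMinimalReprLaplaceFourContraction
import Summits.ValiantsHypothesis.ValiantsHypothesis.Theorems.RigidityForcesSymmetryRankRigidMinimalReprLaplaceFourLineE3
import Summits.ValiantsHypothesis.ValiantsHypothesis.Theorems.RigidityForcesSymmetryRankRigidMinimalReprLaplaceFourProfile311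
import Summits.ValiantsHypothesis.ValiantsHypothesis.Theorems.RigidityForcesSymmetryRankRigidMinimalReprLaplaceFourProfile211s

/-!
# The profile `(4,1,0)` of `LaplaceOptimal 4` is impossible — the pencil normal form
# (crux `RankRigidMinimalRepr`, stmt-ValiantsHypothesis-18034, route `RigidityForcesSymmetry`)

`profile_410`: the permutation pattern `P₄` is NOT of the form
`Σ_{t<4} g_t(v₀,v₁) h_t(v₂,v₃) + b(v₀,v₂) b′(v₁,v₃)` (four pair terms on `01|23` and one on `02|13`; Laplace weight
`20 < 24`).  Equivalently: the `16 × 16` flattening of `P₄` minus a Kronecker product `b ⊗ b′` always has rank `≥ 5`.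

Proof (pencil normal form).  Let `N = span{h_t}` (`dim ≤ 4`); every `A(ψ,φ) = Q(ψ,φ) - (bᵀψ)(b′ᵀφ)ᵀ` lies in `N`.
The map `ψ ↦ A(ψ,𝟙) = pencil ψ - (bᵀψ) sᵀ` (`s` = the column sums of `b′`) is injective, because a symmetric rank-one
matrix with zero diagonal vanishes (`symm_rank_one_eq_zero`) and `pencil` is injective; so it is ONTO `N`
(`nf_410`): `Q(e_z,e_w) - pencil ψ = b_z b′_wᵀ - (bᵀψ) sᵀ` for a suitable `ψ = ψ(z,w)`, the left side being symmetric with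
zero diagonal.
* If all rows of `b′` are multiples of one vector (`profile_410_core`), the right side has rank `≤ 1`, hence vanishes, and
  `E^{01} = pencil ψ` is absurd.  By the mirror symmetry the same holds for `b`.
* Otherwise `s ≠ 0` and some row `v = b′_{w₀}` is not parallel to `s`; the antisymmetric part of the identity gives
  `b_z ∧ v = r ∧ s`, whence every row `b_z = α_z v + β_z s`; its symmetric part and its diagonal then force
  `α_z (v_i s_j + v_j s_i) + 2 β_z s_i s_j = 0`, i.e. all rows of `b` are multiples of one vector — the mirror case.

HONEST FRAMING: a finite tensor statement toward `LaplaceOptimal 4` (rung `TiedTorusBound 3`); the crux stays OPEN;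
nothing here bears on `VP ≠ VNP`.
-/

set_option autoImplicit false

-- the mandated summit-side namespace repeats a component by design (single-problem summit)
set_option linter.dupNamespace false

namespace Summit.ValiantsHypothesis.ValiantsHypothesis.Theorems.RigidityForcesSymmetryRankRigidMinimalRepr

namespace LaplaceFourLine

open Module Matrix LaplaceFourContraction LaplaceFourPencil

/-! ### §0 Small facts about `Q` and `pencil` -/

/-- `Q(ψ,φ)` is a symmetric matrix. -/
theorem contractQ_symm (ψ φ : Fin 4 → ℂ) (a c : Fin 4) :
    contract₀₁ permPattern₄ ψ φ a c = contract₀₁ permPattern₄ ψ φ c a := by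
  rw [contract_permPattern_entries]
  fin_cases a <;> fin_cases c <;> rfl

/-- `Q(ψ,φ)` has zero diagonal. -/
theorem contractQ_diag (ψ φ : Fin 4 → ℂ) (a : Fin 4) : contract₀₁ permPattern₄ ψ φ a a = 0 := by
  rw [contract_permPattern_entries]
  fin_cases a <;> rfl

/-- `pencil t` is symmetric. -/
theorem pencil_symm (t : Fin 4 → ℂ) (a c : Fin 4) : pencil t a c = pencil t c a := by
  simp only [pencil, Matrix.of_apply]
  by_cases h : a = c
  · subst h; rfl
  · rw [if_neg h, if_neg (Ne.symm h)]; ring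

/-- `pencil t` has zero diagonal. -/
theorem pencil_diag (t : Fin 4 → ℂ) (a : Fin 4) : pencil t a a = 0 := by
  simp [pencil]

/-- Off-diagonal entries of `pencil t`. -/
theorem pencil_off (t : Fin 4 → ℂ) {a c : Fin 4} (h : a ≠ c) : pencil t a c = (∑ i, t i) - t a - t c := by
  simp [pencil, h]

/-- `pencil` is injective. -/
theorem pencil_eq_zero (t : Fin 4 → ℂ) (h : ∀ a c, pencil t a c = 0) : t = 0 := by
  have h01 := h 0 1
  have h23 := h 2 3
  have h02 := h 0 2
  have h12 := h 1 2
  have h03 := h 0 3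
  rw [pencil_off t (by decide)] at h01 h23 h02 h12 h03
  simp only [Fin.sum_univ_four] at h01 h23 h02 h12 h03
  funext i
  fin_cases i
  · show t 0 = 0; linear_combination (h12 - h02 + h23) / 2
  · show t 1 = 0; linear_combination (h23 - h12 + h02) / 2
  · show t 2 = 0; linear_combination h03 - (h23 - h12 + h02) / 2
  · show t 3 = 0; linear_combination h01 - h03 + (h23 - h12 + h02) / 2

/-- `pencil` is additive. -/
theorem pencil_add (t t' : Fin 4 → ℂ) : pencil (t + t') = pencil t + pencil t' := by
  ext i j
  simp only [pencil, Matrix.of_apply, Matrix.add_apply, Pi.add_apply, Finset.sum_add_distrib]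
  split_ifs <;> ring

/-- `pencil` is homogeneous. -/
theorem pencil_smul (c : ℂ) (t : Fin 4 → ℂ) : pencil (c • t) = c • pencil t := by
  ext i j
  simp only [pencil, Matrix.of_apply, Matrix.smul_apply, Pi.smul_apply, smul_eq_mul, ← Finset.mul_sum]
  split_ifs <;> ring

/-! ### §1 The pencil normal form of the noise space -/

/-- **Pencil normal form.**  For a decomposition of the profile `(4,1,0)`, every `Q(ψ′,φ′) - (Bψ′)(B′φ′)ᵀ` equals
`pencil ψ - (Bψ) sᵀ` for some `ψ`, where `s_j = Σ_w b′_{wj}`. -/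
theorem nf_410 (g h : Fin 4 → Fin 4 → Fin 4 → ℂ) (b b' : Fin 4 → Fin 4 → ℂ)
    (hsum : ∀ v, permPattern₄ v = (∑ t, g t (v 0) (v 1) * h t (v 2) (v 3)) + b (v 0) (v 2) * b' (v 1) (v 3))
    (ψ' φ' : Fin 4 → ℂ) : ∃ ψ : Fin 4 → ℂ,
    contract₀₁ permPattern₄ ψ' φ' - vecMulVec (fun i => ∑ z, ψ' z * b z i) (fun j => ∑ w, φ' w * b' w j) =
      pencil ψ - vecMulVec (fun i => ∑ z, ψ z * b z i) (fun j => ∑ w, b' w j) := by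
  classical
  let N : Submodule ℂ (Matrix (Fin 4) (Fin 4) ℂ) := Submodule.span ℂ (Set.range fun t : Fin 4 => Matrix.of (h t))
  have hN4 : finrank ℂ N ≤ 4 := (finrank_range_le_card _).trans (by simp)
  have hA : ∀ ψ φ : Fin 4 → ℂ, contract₀₁ permPattern₄ ψ φ -
      vecMulVec (fun i => ∑ z, ψ z * b z i) (fun j => ∑ w, φ w * b' w j) ∈ N := by
    intro ψ φ
    have : contract₀₁ permPattern₄ ψ φ = (∑ t, (∑ x, ∑ y, ψ x * φ y * g t x y) • Matrix.of (h t)) +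
        vecMulVec (fun i => ∑ z, ψ z * b z i) (fun j => ∑ w, φ w * b' w j) := by
      rw [contract_congr hsum]
      have hsplit : (fun v => (∑ t, g t (v 0) (v 1) * h t (v 2) (v 3)) + b (v 0) (v 2) * b' (v 1) (v 3)) =
          fun v => ∑ k : Fin 2, (![fun v => ∑ t, g t (v 0) (v 1) * h t (v 2) (v 3),
            fun v => b (v 0) (v 2) * b' (v 1) (v 3)] : Fin 2 → (Fin 4 → Fin 4) → ℂ) k v := by
        funext v; simp [Fin.sum_univ_two]
      rw [contract_congr (fun v => congrFun hsplit v), contract_sum, Fin.sum_univ_two]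
      simp only [Matrix.cons_val_zero, Matrix.cons_val_one]
      rw [contract_sum Finset.univ (fun t v => g t (v 0) (v 1) * h t (v 2) (v 3)), contract_pair02]
      congr 1
      exact Finset.sum_congr rfl fun t _ => contract_pair01 _ _ ψ φ
    rw [this, add_sub_cancel_right]
    exact Submodule.sum_mem _ fun t _ => Submodule.smul_mem _ _ (Submodule.subset_span ⟨t, rfl⟩)
  -- the map `ψ ↦ A(ψ,𝟙)`
  let L : (Fin 4 → ℂ) →ₗ[ℂ] Matrix (Fin 4) (Fin 4) ℂ :=
    { toFun := fun ψ => pencil ψ - vecMulVec (fun i => ∑ z, ψ z * b z i) (fun j => ∑ w, b' w j)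
      map_add' := fun x y => by
        rw [pencil_add]
        ext i j
        simp only [Matrix.sub_apply, Matrix.add_apply, vecMulVec_apply, Pi.add_apply, add_mul,
          Finset.sum_add_distrib]
        ring
      map_smul' := fun c x => by
        rw [pencil_smul]
        ext i j
        simp only [Matrix.sub_apply, Matrix.smul_apply, vecMulVec_apply, Pi.smul_apply, smul_eq_mul,
          RingHom.id_apply, mul_assoc, ← Finset.mul_sum]
        ring }
  have hL : ∀ ψ, L ψ = contract₀₁ permPattern₄ ψ 1 -
      vecMulVec (fun i => ∑ z, ψ z * b z i) (fun j => ∑ w, (1 : Fin 4 → ℂ) w * b' w j) := by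
    intro ψ
    simp only [L, LinearMap.coe_mk, AddHom.coe_mk, contract_permPattern_one, Pi.one_apply, one_mul]
  have hLN : LinearMap.range L ≤ N := by
    rintro _ ⟨ψ, rfl⟩
    rw [hL]
    exact hA ψ 1
  have hinj : Function.Injective L := by
    rw [← LinearMap.ker_eq_bot, LinearMap.ker_eq_bot']
    intro ψ hψ
    have h0 : ∀ i j, pencil ψ i j = (∑ z, ψ z * b z i) * (∑ w, b' w j) := by
      intro i j
      have := congrFun (congrFun hψ i) j
      simp only [L, LinearMap.coe_mk, AddHom.coe_mk, Matrix.sub_apply, vecMulVec_apply, Matrix.zero_apply] at this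
      linear_combination this
    exact pencil_eq_zero ψ (symm_rank_one_eq_zero (fun i j => pencil ψ i j) _ _ (pencil_symm ψ) (pencil_diag ψ) h0)
  have hfr : finrank ℂ (LinearMap.range L) = 4 := by
    rw [LinearMap.finrank_range_of_inj hinj]; simp
  have hEq : LinearMap.range L = N := Submodule.eq_of_le_of_finrank_le hLN (by rw [hfr]; exact hN4)
  have hmem : contract₀₁ permPattern₄ ψ' φ' -
      vecMulVec (fun i => ∑ z, ψ' z * b z i) (fun j => ∑ w, φ' w * b' w j) ∈ LinearMap.range L := by
    rw [hEq]; exact hA ψ' φ'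
  obtain ⟨ψ, hψ⟩ := LinearMap.mem_range.1 hmem
  exact ⟨ψ, hψ.symm⟩

/-- The pencil normal form at `(e_z, e_w)`, entrywise. -/
theorem nf_410_single (g h : Fin 4 → Fin 4 → Fin 4 → ℂ) (b b' : Fin 4 → Fin 4 → ℂ)
    (hsum : ∀ v, permPattern₄ v = (∑ t, g t (v 0) (v 1) * h t (v 2) (v 3)) + b (v 0) (v 2) * b' (v 1) (v 3))
    (z w : Fin 4) : ∃ ψ : Fin 4 → ℂ, ∀ a c,
    contract₀₁ permPattern₄ (Pi.single z 1) (Pi.single w 1) a c - b z a * b' w c =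
      pencil ψ a c - (∑ z', ψ z' * b z' a) * (∑ w', b' w' c) := by
  obtain ⟨ψ, hψ⟩ := nf_410 g h b b' hsum (Pi.single z 1) (Pi.single w 1)
  refine ⟨ψ, fun a c => ?_⟩
  have := congrFun (congrFun hψ a) c
  simpa [vecMulVec_apply, Pi.single_apply] using this

/-! ### §2 The degenerate case: `b′` of rank `≤ 1` -/

/-- If all rows of `b′` are multiples of one vector, the profile `(4,1,0)` is impossible. -/
theorem profile_410_core (g h : Fin 4 → Fin 4 → Fin 4 → ℂ) (b b' : Fin 4 → Fin 4 → ℂ)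
    (hsum : ∀ v, permPattern₄ v = (∑ t, g t (v 0) (v 1) * h t (v 2) (v 3)) + b (v 0) (v 2) * b' (v 1) (v 3))
    (v₀ β : Fin 4 → ℂ) (hb' : ∀ w j, b' w j = β w * v₀ j) : False := by
  obtain ⟨ψ, hψ⟩ := nf_410_single g h b b' hsum 2 3
  have hs : ∀ c, (∑ w', b' w' c) = (∑ w', β w') * v₀ c := by
    intro c; rw [Finset.sum_mul]; exact Finset.sum_congr rfl fun w' _ => hb' w' c
  -- `Q(e₂,e₃) - pencil ψ` is symmetric, has zero diagonal and rank `≤ 1`: it vanishes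
  have hz := symm_rank_one_eq_zero
    (fun a c => contract₀₁ permPattern₄ (Pi.single 2 (1 : ℂ)) (Pi.single 3 1) a c - pencil ψ a c)
    (fun a => β 3 * b 2 a - (∑ w', β w') * ∑ z', ψ z' * b z' a) v₀
    (fun a c => show contract₀₁ permPattern₄ (Pi.single 2 (1 : ℂ)) (Pi.single 3 1) a c - pencil ψ a c =
        contract₀₁ permPattern₄ (Pi.single 2 (1 : ℂ)) (Pi.single 3 1) c a - pencil ψ c a by
      rw [contractQ_symm, pencil_symm])
    (fun a => show contract₀₁ permPattern₄ (Pi.single 2 (1 : ℂ)) (Pi.single 3 1) a a - pencil ψ a a = 0 by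
      rw [contractQ_diag, pencil_diag, sub_zero])
    (fun a c => show contract₀₁ permPattern₄ (Pi.single 2 (1 : ℂ)) (Pi.single 3 1) a c - pencil ψ a c = _ by
      linear_combination hψ a c + b 2 a * hb' 3 c - (∑ z', ψ z' * b z' a) * hs c)
  have e01 : contract₀₁ permPattern₄ (Pi.single 2 (1 : ℂ)) (Pi.single 3 1) 0 1 - pencil ψ 0 1 = 0 := hz 0 1
  have e23 : contract₀₁ permPattern₄ (Pi.single 2 (1 : ℂ)) (Pi.single 3 1) 2 3 - pencil ψ 2 3 = 0 := hz 2 3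
  have e02 : contract₀₁ permPattern₄ (Pi.single 2 (1 : ℂ)) (Pi.single 3 1) 0 2 - pencil ψ 0 2 = 0 := hz 0 2
  have e13 : contract₀₁ permPattern₄ (Pi.single 2 (1 : ℂ)) (Pi.single 3 1) 1 3 - pencil ψ 1 3 = 0 := hz 1 3
  rw [contract_single_single, pencil_off ψ (by decide)] at e01 e23 e02 e13
  simp only [Fin.sum_univ_four, Fin.isValue, ne_eq, Fin.reduceEq, not_false_eq_true, not_true_eq_false, and_true,
    and_false, and_self, if_true, if_false] at e01 e23 e02 e13
  exact one_ne_zero (by linear_combination e01 + e23 - e02 - e13 : (1 : ℂ) = 0)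

/-! ### §3 The profile `(4,1,0)` -/

/-- **The profile `(4,1,0)` is impossible**: `P₄` is not a sum of four pair terms on `01|23` and one on `02|13`
(equivalently, the `01|23` flattening of `P₄` minus any Kronecker product `b ⊗ b′` has rank `≥ 5`). -/
theorem profile_410 (g h : Fin 4 → Fin 4 → Fin 4 → ℂ) (b b' : Fin 4 → Fin 4 → ℂ)
    (hsum : ∀ v, permPattern₄ v = (∑ t, g t (v 0) (v 1) * h t (v 2) (v 3)) + b (v 0) (v 2) * b' (v 1) (v 3)) :
    False := by
  classical
  by_cases H' : ∃ v₀ β : Fin 4 → ℂ, ∀ w j, b' w j = β w * v₀ j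
  · obtain ⟨v₀, β, hb'⟩ := H'
    exact profile_410_core g h b b' hsum v₀ β hb'
  by_cases H : ∃ u₀ μ : Fin 4 → ℂ, ∀ z i, b z i = μ z * u₀ i
  · -- the mirror decomposition swaps the roles of `b` and `b′`
    obtain ⟨u₀, μ, hb⟩ := H
    refine profile_410_core (fun t x y => g t y x) (fun t i j => h t j i) b' b (fun v => ?_) u₀ μ hb
    rw [← permPattern_mirror v, hsum]
    simp only [Matrix.cons_val_zero, Matrix.cons_val_one, Matrix.head_cons, Matrix.cons_val_two, Matrix.tail_cons,
      Matrix.cons_val_three]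
    ring
  push Not at H H'
  -- the column sums `s` of `b′`
  obtain ⟨s, hs_def⟩ : ∃ s : Fin 4 → ℂ, ∀ j, (∑ w, b' w j) = s j := ⟨_, fun _ => rfl⟩
  -- `s ≠ 0`: otherwise every `b_z b′_wᵀ` is symmetric with zero diagonal, hence zero
  have hs : ∃ k, s k ≠ 0 := by
    by_contra h0
    push Not at h0
    have hzero : ∀ z w a c, b z a * b' w c = 0 := by
      intro z w
      obtain ⟨ψ, hψ⟩ := nf_410_single g h b b' hsum z w
      have hn : ∀ a c, contract₀₁ permPattern₄ (Pi.single z (1 : ℂ)) (Pi.single w 1) a c - pencil ψ a c =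
          b z a * b' w c := by
        intro a c
        have h1 := hψ a c
        rw [hs_def c, h0 c, mul_zero, sub_zero] at h1
        linear_combination h1
      have hz := symm_rank_one_eq_zero
        (fun a c => contract₀₁ permPattern₄ (Pi.single z (1 : ℂ)) (Pi.single w 1) a c - pencil ψ a c)
        (fun a => b z a) (fun c => b' w c)
        (fun a c => show contract₀₁ permPattern₄ (Pi.single z (1 : ℂ)) (Pi.single w 1) a c - pencil ψ a c =
            contract₀₁ permPattern₄ (Pi.single z (1 : ℂ)) (Pi.single w 1) c a - pencil ψ c a by
          rw [contractQ_symm, pencil_symm])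
        (fun a => show contract₀₁ permPattern₄ (Pi.single z (1 : ℂ)) (Pi.single w 1) a a - pencil ψ a a = 0 by
          rw [contractQ_diag, pencil_diag, sub_zero]) hn
      intro a c
      exact (hn a c).symm.trans (hz a c)
    obtain ⟨z₀, i₀, hzi⟩ := H 0 0
    obtain ⟨w₀, j₀, hwj⟩ := H' 0 0
    simp only [Pi.zero_apply, mul_zero] at hzi hwj
    exact hwj ((mul_eq_zero.1 (hzero z₀ w₀ i₀ j₀)).resolve_left hzi)
  obtain ⟨k, hk⟩ := hs
  -- a row `v = b′_{w₀}` not parallel to `s`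
  obtain ⟨w₀, j₀, hwj⟩ := H' s fun w => b' w k / s k
  obtain ⟨v, hv⟩ : ∃ v : Fin 4 → ℂ, ∀ c, b' w₀ c = v c := ⟨_, fun _ => rfl⟩
  obtain ⟨m, hm_def⟩ : ∃ m : ℂ, v j₀ * s k - v k * s j₀ = m := ⟨_, rfl⟩
  have hm : m ≠ 0 := by
    intro h0; apply hwj; rw [hv, hv]; field_simp; linear_combination hm_def + h0
  -- the normal form at `(e_z, e_{w₀})`, with `r_z = bᵀ ψ_z`
  choose ψ hψ using fun z => nf_410_single g h b b' hsum z w₀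
  obtain ⟨r, hr_def⟩ : ∃ r : Fin 4 → Fin 4 → ℂ, ∀ z a, (∑ z', ψ z z' * b z' a) = r z a := ⟨_, fun _ _ => rfl⟩
  have hE : ∀ z a c, contract₀₁ permPattern₄ (Pi.single z (1 : ℂ)) (Pi.single w₀ 1) a c - b z a * v c =
      pencil (ψ z) a c - r z a * s c := by
    intro z a c
    rw [← hv, ← hr_def, ← hs_def]
    exact hψ z a c
  -- antisymmetric part: `b_z ∧ v = r_z ∧ s`
  have hW : ∀ z a c, b z a * v c - b z c * v a = r z a * s c - r z c * s a := by
    intro z a c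
    have h1 := hE z a c
    have h2 := hE z c a
    rw [contractQ_symm, pencil_symm] at h2
    linear_combination h2 - h1
  -- diagonal part
  have hD : ∀ z a, b z a * v a = r z a * s a := by
    intro z a
    have h1 := hE z a a
    rw [contractQ_diag, pencil_diag] at h1
    linear_combination -h1
  -- every row of `b` lies in `span(v, s)`
  obtain ⟨α, hα_def⟩ : ∃ α : Fin 4 → ℂ, ∀ z, (b z j₀ * s k - b z k * s j₀) / m = α z := ⟨_, fun _ => rfl⟩
  obtain ⟨βc, hβ_def⟩ : ∃ β : Fin 4 → ℂ, ∀ z, (v j₀ * b z k - v k * b z j₀) / m = β z := ⟨_, fun _ => rfl⟩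
  have hb : ∀ z c, b z c = α z * v c + βc z * s c := by
    intro z c
    have key : m * b z c = (b z j₀ * s k - b z k * s j₀) * v c + (v j₀ * b z k - v k * b z j₀) * s c := by
      rw [← hm_def]
      linear_combination s k * hW z c j₀ + s j₀ * hW z k c + s c * hW z j₀ k
    rw [← hα_def, ← hβ_def]
    field_simp
    linear_combination key
  -- `r_z = ρ₁ v + ρ₂ s`
  have hr : ∀ z a, r z a = (∑ z', ψ z z' * α z') * v a + (∑ z', ψ z z' * βc z') * s a := by
    intro z a
    rw [← hr_def, Finset.sum_mul, Finset.sum_mul, ← Finset.sum_add_distrib]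
    exact Finset.sum_congr rfl fun z' _ => by rw [hb z' a]; ring
  -- symmetric part: `β_z = -ρ₁`
  have hβρ : ∀ z, βc z + (∑ z', ψ z z' * α z') = 0 := by
    intro z
    have h1 := hW z j₀ k
    rw [hb z j₀, hb z k, hr z j₀, hr z k] at h1
    have : (βc z + ∑ z', ψ z z' * α z') * m = 0 := by rw [← hm_def]; linear_combination -h1
    exact (mul_eq_zero.1 this).resolve_right hm
  -- diagonal: `α_z v_a² + 2 β_z v_a s_a - ρ₂ s_a² = 0`
  have hDa : ∀ z a, α z * v a ^ 2 + 2 * βc z * v a * s a - (∑ z', ψ z z' * βc z') * s a ^ 2 = 0 := by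
    intro z a
    have h1 := hD z a
    rw [hb z a, hr z a] at h1
    linear_combination h1 + v a * s a * hβρ z
  -- hence `α_z (v_i s_j + v_j s_i) + 2 β_z s_i s_j = 0`
  have hAB : ∀ z, α z * (v j₀ * s k + v k * s j₀) + 2 * βc z * (s j₀ * s k) = 0 := by
    intro z
    have : m * (α z * (v j₀ * s k + v k * s j₀) + 2 * βc z * (s j₀ * s k)) = 0 := by
      rw [← hm_def]; linear_combination s k ^ 2 * hDa z j₀ - s j₀ ^ 2 * hDa z k
    exact (mul_eq_zero.1 this).resolve_left hm
  -- so all rows of `b` are multiples of one vector: the mirror case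
  by_cases hB : s j₀ * s k = 0
  · -- then `A ≠ 0` and `α = 0`: the rows are multiples of `s`
    have hA : v j₀ * s k + v k * s j₀ ≠ 0 := by
      intro hA
      rcases mul_eq_zero.1 hB with h0 | h0
      · apply hm; rw [← hm_def]; linear_combination hA - 2 * v k * h0
      · exact hk h0
    obtain ⟨z, c, hzc⟩ := H s βc
    apply hzc
    have hα0 : α z = 0 := by
      have := hAB z
      rw [hB, mul_zero, add_zero] at this
      exact (mul_eq_zero.1 this).resolve_right hA
    rw [hb z c, hα0, zero_mul, zero_add]
  · obtain ⟨hj0, hk0⟩ := mul_ne_zero_iff.1 hB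
    obtain ⟨z, c, hzc⟩ := H (fun c => v c - (v j₀ * s k + v k * s j₀) / (2 * (s j₀ * s k)) * s c) α
    apply hzc
    have h2 : (2 : ℂ) * (s j₀ * s k) ≠ 0 := mul_ne_zero two_ne_zero hB
    have hβ' : βc z = -(α z * (v j₀ * s k + v k * s j₀)) / (2 * (s j₀ * s k)) := by
      rw [eq_div_iff h2]
      linear_combination hAB z
    rw [hb z c, hβ']
    field_simp
    ring

end LaplaceFourLine

end Summit.ValiantsHypothesis.ValiantsHypothesis.Theorems.RigidityForcesSymmetryRankRigidMinimalRepr
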